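import Summits.SmoothPoincare4.SmoothPoincare4.Theorems.CongruenceShadowsShadowApproximationStubLayerStepZeroTwoDatum
import Summits.SmoothPoincare4.SmoothPoincare4.Theorems.CongruenceShadowsShadowApproximationStubLayerStepZeroTwoBp
import Summits.SmoothPoincare4.SmoothPoincare4.Theorems.CongruenceShadowsShadowApproximationStubLayerStepZeroTwoXFour
import Summits.SmoothPoincare4.SmoothPoincare4.Theorems.CongruenceShadowsShadowApproximationStubLayerStepZeroTwoLieCoeff
import Summits.SmoothPoincare4.SmoothPoincare4.Theorems.CongruenceShadowsShadowApproximationStubLayerStepZeroOneRealisers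
import Mathlib.Tactic.NoncommRing
import HarnessLib

/-!
# Helper VIII (the six realisers in degree three) for stub `stub_layerStepZeroTwo` of line `nilpotent-genus-class`,
crux `CongruenceShadows.ShadowApproximation` (item stmt-SmoothPoincare4-14595)

Genus `3`, notation of the siblings.  Assembles the degree-three datum of a commutator realiser
`V = ⁅g β g⁻¹, g' T_h g'⁻¹⁆` from the homology actions `F, F'` of `g, g'` (`datum_bp_type`: `datum_comm` with the classes
and data of the siblings `…Bp`, `…Datum` substituted), and of `V₄ = ⁅x₄, e₁₂ T₁ e₁₂⁻¹⁆` (`datum_x4_type`, sibling `…XFour`);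
Goeritz elements are closed under commutators in `Aut S₃` (`map_commAut_eq`).  The six realisers themselves are in the
sequels `…RealisersA/B`.
No definitions, no notations.
-/

set_option linter.dupNamespace false
set_option linter.unusedSimpArgs false

noncomputable section

open Subgroup Literature.Topology.FourManifolds Literature.Algebra.Lie Multiplicative
open Summit.SmoothPoincare4.SmoothPoincare4.Theorems.NilpotentShadowsStandard.SaturatedTorsorDescent
open scoped commutatorElement

namespace Summit.SmoothPoincare4.SmoothPoincare4.Theorems.ShadowApproximation.NilpotentGenusClass

namespace LayerZeroTwo

open LayerZeroOne

/-! ## Goeritz elements are closed under commutators -/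

/-- A commutator (in `Aut G`) of stabilisers of `P` stabilises `P`. [folklore] -/
theorem map_commAut_eq {G : Type*} [Group G] (x U : G ≃* G) {P : Subgroup G}
    (hx : P.map x.toMonoidHom = P) (hU : P.map U.toMonoidHom = P) :
    P.map (⁅(x : MulAut G), (U : MulAut G)⁆ : MulAut G).toMonoidHom = P := by
  have e : (⁅(x : MulAut G), (U : MulAut G)⁆ : MulAut G) = ((U.symm.trans x.symm).trans U).trans x := by
    ext s; rw [commAut_apply]; rfl
  rw [e, map_trans, map_trans, map_trans, map_symm_of_map _ hU, map_symm_of_map _ hx, hU, hx]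

section Symbols

variable (θ : ℕ → FreeGroup (Fin 3) → FreeLieAlgebra ℤ (Fin 3))
  (hadd : ∀ k, ∀ x ∈ (⊤ : Subgroup (FreeGroup (Fin 3))).lowerCentralSeries k,
    ∀ y ∈ (⊤ : Subgroup (FreeGroup (Fin 3))).lowerCentralSeries k, θ k (x * y) = θ k x + θ k y)
  (hker : ∀ k, ∀ x ∈ (⊤ : Subgroup (FreeGroup (Fin 3))).lowerCentralSeries k,
    θ k x = 0 ↔ x ∈ (⊤ : Subgroup (FreeGroup (Fin 3))).lowerCentralSeries (k + 1))
  (hof : ∀ i : Fin 3, θ 0 (FreeGroup.of i) = FreeLieAlgebra.of ℤ i)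
  (hbr : ∀ j k, ∀ x ∈ (⊤ : Subgroup (FreeGroup (Fin 3))).lowerCentralSeries j,
    ∀ y ∈ (⊤ : Subgroup (FreeGroup (Fin 3))).lowerCentralSeries k, θ (j + k + 1) ⁅x, y⁆ = ⁅θ j x, θ k y⁆)
  (π : SurfaceGroup 3 →* FreeGroup (Fin 3))
  (hπof : ∀ (h : Fin 3) (b : Bool), π (PresentedGroup.of (h, b)) = if b = (![true, false, false] : Fin 3 → Bool) h then 1 else FreeGroup.of h)

include hadd hker hbr in
/-- **The degree-three datum of `V = ⁅g β g⁻¹, g' T_h g'⁻¹⁆` in terms of the homology actions** `F` of `g` and `F'` of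
`g'` (`β` the bounding-pair map, `T_h` the handle twist): `datum_comm` with the classes `bpconj_class`, `conj_twist_class`
and the data `bpconj_datum`, `datum_conj_twist'` substituted; the five remaining atoms are the reduced classes
`θ₀π(g' a_h), θ₀π(g' b_h), θ₀π(g a₀), θ₀π(g b₀), θ₀π(g b₁)`. [folklore] -/
theorem datum_bp_type (β g g' T' : SurfaceGroup 3 ≃* SurfaceGroup 3) (F F' : (surfaceGen 3 → ℤ) ≃ₗ[ℤ] (surfaceGen 3 → ℤ)) (h : Fin 3)
    (hβIA : ∀ s, β s * s⁻¹ ∈ (⊤ : Subgroup (SurfaceGroup 3)).lowerCentralSeries 1)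
    (hβa0 : (((β (PresentedGroup.of ((0 : Fin 3), false)) * (PresentedGroup.of ((0 : Fin 3), false) : SurfaceGroup 3)⁻¹ : SurfaceGroup 3)) :
        SurfaceGroup 3 ⧸ (⊤ : Subgroup (SurfaceGroup 3)).lowerCentralSeries 2) =
      ⁅((PresentedGroup.of ((1 : Fin 3), true) : SurfaceGroup 3) : SurfaceGroup 3 ⧸ (⊤ : Subgroup (SurfaceGroup 3)).lowerCentralSeries 2)⁻¹,
        ((PresentedGroup.of ((0 : Fin 3), false) : SurfaceGroup 3) : SurfaceGroup 3 ⧸ (⊤ : Subgroup (SurfaceGroup 3)).lowerCentralSeries 2)⁆)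
    (hβb0 : (((β (PresentedGroup.of ((0 : Fin 3), true)) * (PresentedGroup.of ((0 : Fin 3), true) : SurfaceGroup 3)⁻¹ : SurfaceGroup 3)) :
        SurfaceGroup 3 ⧸ (⊤ : Subgroup (SurfaceGroup 3)).lowerCentralSeries 2) =
      ⁅((PresentedGroup.of ((1 : Fin 3), true) : SurfaceGroup 3) : SurfaceGroup 3 ⧸ (⊤ : Subgroup (SurfaceGroup 3)).lowerCentralSeries 2)⁻¹,
        ((PresentedGroup.of ((0 : Fin 3), true) : SurfaceGroup 3) : SurfaceGroup 3 ⧸ (⊤ : Subgroup (SurfaceGroup 3)).lowerCentralSeries 2)⁆)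
    (hβa1 : (((β (PresentedGroup.of ((1 : Fin 3), false)) * (PresentedGroup.of ((1 : Fin 3), false) : SurfaceGroup 3)⁻¹ : SurfaceGroup 3)) :
        SurfaceGroup 3 ⧸ (⊤ : Subgroup (SurfaceGroup 3)).lowerCentralSeries 2) =
      (⁅((PresentedGroup.of ((0 : Fin 3), false) : SurfaceGroup 3) : SurfaceGroup 3 ⧸ (⊤ : Subgroup (SurfaceGroup 3)).lowerCentralSeries 2),
        ((PresentedGroup.of ((0 : Fin 3), true) : SurfaceGroup 3) : SurfaceGroup 3 ⧸ (⊤ : Subgroup (SurfaceGroup 3)).lowerCentralSeries 2)⁆)⁻¹)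
    (hβb1 : (((β (PresentedGroup.of ((1 : Fin 3), true)) * (PresentedGroup.of ((1 : Fin 3), true) : SurfaceGroup 3)⁻¹ : SurfaceGroup 3)) :
        SurfaceGroup 3 ⧸ (⊤ : Subgroup (SurfaceGroup 3)).lowerCentralSeries 2) = 1)
    (hβa2 : β (PresentedGroup.of ((2 : Fin 3), false)) = PresentedGroup.of ((2 : Fin 3), false))
    (hβb2 : β (PresentedGroup.of ((2 : Fin 3), true)) = PresentedGroup.of ((2 : Fin 3), true))
    (hg : ∀ s, toAdd (SurfaceGroup.abelianize 3 (g s)) = F (toAdd (SurfaceGroup.abelianize 3 s)))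
    (hg' : ∀ s, toAdd (SurfaceGroup.abelianize 3 (g' s)) = F' (toAdd (SurfaceGroup.abelianize 3 s)))
    (hT2 : ∀ s, T' s * s⁻¹ ∈ (⊤ : Subgroup (SurfaceGroup 3)).lowerCentralSeries 2)
    (hTh : ∀ c : Bool, T' (PresentedGroup.of (h, c)) * (PresentedGroup.of (h, c) : SurfaceGroup 3)⁻¹ =
      ⁅⁅(PresentedGroup.of (h, false) : SurfaceGroup 3), (PresentedGroup.of (h, true) : SurfaceGroup 3)⁆,
        (PresentedGroup.of (h, c) : SurfaceGroup 3)⁆)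
    (hTne : ∀ y : surfaceGen 3, y.1 ≠ h → T' (PresentedGroup.of y) = PresentedGroup.of y) (X : SurfaceGroup 3) :
    (⁅(g.symm.trans (β.trans g) : MulAut (SurfaceGroup 3)), (g'.symm.trans (T'.trans g') : MulAut (SurfaceGroup 3))⁆ :
        MulAut (SurfaceGroup 3)) X * X⁻¹ ∈ (⊤ : Subgroup (SurfaceGroup 3)).lowerCentralSeries 3 ∧
    θ 3 (π ((⁅(g.symm.trans (β.trans g) : MulAut (SurfaceGroup 3)), (g'.symm.trans (T'.trans g') : MulAut (SurfaceGroup 3))⁆ :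
        MulAut (SurfaceGroup 3)) X * X⁻¹)) =
      (F'.symm (toAdd (SurfaceGroup.abelianize 3 X))) (h, false) • (⁅⁅θ 0 (π (g' (PresentedGroup.of (h, false)))), θ 0 (π (g' (PresentedGroup.of (h, true))))⁆, ((F.symm (F' (Pi.single (h, false) 1))) ((0 : Fin 3), false) • ⁅-θ 0 (π (g (PresentedGroup.of ((1 : Fin 3), true)))), θ 0 (π (g (PresentedGroup.of ((0 : Fin 3), false))))⁆ + (F.symm (F' (Pi.single (h, false) 1))) ((0 : Fin 3), true) • ⁅-θ 0 (π (g (PresentedGroup.of ((1 : Fin 3), true)))), θ 0 (π (g (PresentedGroup.of ((0 : Fin 3), true))))⁆ + (-(F.symm (F' (Pi.single (h, false) 1))) ((1 : Fin 3), false)) • ⁅θ 0 (π (g (PresentedGroup.of ((0 : Fin 3), false)))), θ 0 (π (g (PresentedGroup.of ((0 : Fin 3), true))))⁆)⁆ + ⁅⁅θ 0 (π (g' (PresentedGroup.of (h, false)))), ((F.symm (F' (Pi.single (h, true) 1))) ((0 : Fin 3), false) • ⁅-θ 0 (π (g (PresentedGroup.of ((1 : Fin 3), true)))), θ 0 (π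 (g (PresentedGroup.of ((0 : Fin 3), false))))⁆ + (F.symm (F' (Pi.single (h, true) 1))) ((0 : Fin 3), true) • ⁅-θ 0 (π (g (PresentedGroup.of ((1 : Fin 3), true)))), θ 0 (π (g (PresentedGroup.of ((0 : Fin 3), true))))⁆ + (-(F.symm (F' (Pi.single (h, true) 1))) ((1 : Fin 3), false)) • ⁅θ 0 (π (g (PresentedGroup.of ((0 : Fin 3), false)))), θ 0 (π (g (PresentedGroup.of ((0 : Fin 3), true))))⁆)⁆ + ⁅((F.symm (F' (Pi.single (h, false) 1))) ((0 : Fin 3), false) • ⁅-θ 0 (π (g (PresentedGroup.of ((1 : Fin 3), true)))), θ 0 (π (g (PresentedGroup.of ((0 : Fin 3), false))))⁆ + (F.symm (F' (Pi.single (h, false) 1))) ((0 : Fin 3), true) • ⁅-θ 0 (π (g (PresentedGroup.of ((1 : Fin 3), true)))), θ 0 (π (g (PresentedGroup.of ((0 : Fin 3), true))))⁆ + (-(F.symm (F' (Pi.single (h, false) 1))) ((1 : Fin 3), false)) • ⁅θ 0 (π (g (PresentedGroup.of ((0 : Fin 3), false)))), θ 0 (π (g (PresentedGroup.of ((0 :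 Fin 3), true))))⁆), θ 0 (π (g' (PresentedGroup.of (h, true))))⁆, θ 0 (π (g' (PresentedGroup.of (h, false))))⁆) +
      (F'.symm (toAdd (SurfaceGroup.abelianize 3 X))) (h, true) • (⁅⁅θ 0 (π (g' (PresentedGroup.of (h, false)))), θ 0 (π (g' (PresentedGroup.of (h, true))))⁆, ((F.symm (F' (Pi.single (h, true) 1))) ((0 : Fin 3), false) • ⁅-θ 0 (π (g (PresentedGroup.of ((1 : Fin 3), true)))), θ 0 (π (g (PresentedGroup.of ((0 : Fin 3), false))))⁆ + (F.symm (F' (Pi.single (h, true) 1))) ((0 : Fin 3), true) • ⁅-θ 0 (π (g (PresentedGroup.of ((1 : Fin 3), true)))), θ 0 (π (g (PresentedGroup.of ((0 : Fin 3), true))))⁆ + (-(F.symm (F' (Pi.single (h, true) 1))) ((1 : Fin 3), false)) • ⁅θ 0 (π (g (PresentedGroup.of ((0 : Fin 3), false)))), θ 0 (π (g (PresentedGroup.of ((0 : Fin 3), true))))⁆)⁆ + ⁅⁅θ 0 (π (g' (PresentedGroup.of (h, false)))), ((F.symm (F' (Pi.single (h, true) 1))) ((0 : Fin 3), false) • ⁅-θ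 0 (π (g (PresentedGroup.of ((1 : Fin 3), true)))), θ 0 (π (g (PresentedGroup.of ((0 : Fin 3), false))))⁆ + (F.symm (F' (Pi.single (h, true) 1))) ((0 : Fin 3), true) • ⁅-θ 0 (π (g (PresentedGroup.of ((1 : Fin 3), true)))), θ 0 (π (g (PresentedGroup.of ((0 : Fin 3), true))))⁆ + (-(F.symm (F' (Pi.single (h, true) 1))) ((1 : Fin 3), false)) • ⁅θ 0 (π (g (PresentedGroup.of ((0 : Fin 3), false)))), θ 0 (π (g (PresentedGroup.of ((0 : Fin 3), true))))⁆)⁆ + ⁅((F.symm (F' (Pi.single (h, false) 1))) ((0 : Fin 3), false) • ⁅-θ 0 (π (g (PresentedGroup.of ((1 : Fin 3), true)))), θ 0 (π (g (PresentedGroup.of ((0 : Fin 3), false))))⁆ + (F.symm (F' (Pi.single (h, false) 1))) ((0 : Fin 3), true) • ⁅-θ 0 (π (g (PresentedGroup.of ((1 : Fin 3), true)))), θ 0 (π (g (PresentedGroup.of ((0 : Fin 3), true))))⁆ + (-(F.symm (F' (Pi.single (h, false) 1))) ((1 : Fin 3), false)) • ⁅θ 0 (π (g (PresentedGroup.of ((0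 : Fin 3), false)))), θ 0 (π (g (PresentedGroup.of ((0 : Fin 3), true))))⁆), θ 0 (π (g' (PresentedGroup.of (h, true))))⁆, θ 0 (π (g' (PresentedGroup.of (h, true))))⁆) -
      ((F.symm (toAdd (SurfaceGroup.abelianize 3 X))) ((0 : Fin 3), false) • (⁅-θ 0 (π (g (PresentedGroup.of ((1 : Fin 3), true)))), ((F'.symm (F (Pi.single ((0 : Fin 3), false) 1))) (h, false) • ⁅⁅θ 0 (π (g' (PresentedGroup.of (h, false)))), θ 0 (π (g' (PresentedGroup.of (h, true))))⁆, θ 0 (π (g' (PresentedGroup.of (h, false))))⁆ + (F'.symm (F (Pi.single ((0 : Fin 3), false) 1))) (h, true) • ⁅⁅θ 0 (π (g' (PresentedGroup.of (h, false)))), θ 0 (π (g' (PresentedGroup.of (h, true))))⁆, θ 0 (π (g' (PresentedGroup.of (h, true))))⁆)⁆ + ⁅((F'.symm (-F (Pi.single ((1 : Fin 3), true) 1))) (h, false) • ⁅⁅θ 0 (π (g' (PresentedGroup.of (h, false)))), θ 0 (π (g' (PresentedGroup.of (h, true))))⁆, θ 0 (π (g' (PresentedGroup.of (h, false))))⁆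 + (F'.symm (-F (Pi.single ((1 : Fin 3), true) 1))) (h, true) • ⁅⁅θ 0 (π (g' (PresentedGroup.of (h, false)))), θ 0 (π (g' (PresentedGroup.of (h, true))))⁆, θ 0 (π (g' (PresentedGroup.of (h, true))))⁆), θ 0 (π (g (PresentedGroup.of ((0 : Fin 3), false))))⁆) +
        (F.symm (toAdd (SurfaceGroup.abelianize 3 X))) ((0 : Fin 3), true) • (⁅-θ 0 (π (g (PresentedGroup.of ((1 : Fin 3), true)))), ((F'.symm (F (Pi.single ((0 : Fin 3), true) 1))) (h, false) • ⁅⁅θ 0 (π (g' (PresentedGroup.of (h, false)))), θ 0 (π (g' (PresentedGroup.of (h, true))))⁆, θ 0 (π (g' (PresentedGroup.of (h, false))))⁆ + (F'.symm (F (Pi.single ((0 : Fin 3), true) 1))) (h, true) • ⁅⁅θ 0 (π (g' (PresentedGroup.of (h, false)))), θ 0 (π (g' (PresentedGroup.of (h, true))))⁆, θ 0 (π (g' (PresentedGroup.of (h, true))))⁆)⁆ + ⁅((F'.symm (-F (Pi.single ((1 : Fin 3), true) 1))) (h, false) • ⁅⁅θ 0 (π (g' (PresentedGroup.of (h, false)))),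 θ 0 (π (g' (PresentedGroup.of (h, true))))⁆, θ 0 (π (g' (PresentedGroup.of (h, false))))⁆ + (F'.symm (-F (Pi.single ((1 : Fin 3), true) 1))) (h, true) • ⁅⁅θ 0 (π (g' (PresentedGroup.of (h, false)))), θ 0 (π (g' (PresentedGroup.of (h, true))))⁆, θ 0 (π (g' (PresentedGroup.of (h, true))))⁆), θ 0 (π (g (PresentedGroup.of ((0 : Fin 3), true))))⁆) +
        (-(F.symm (toAdd (SurfaceGroup.abelianize 3 X))) ((1 : Fin 3), false)) • (⁅θ 0 (π (g (PresentedGroup.of ((0 : Fin 3), false)))), ((F'.symm (F (Pi.single ((0 : Fin 3), true) 1))) (h, false) • ⁅⁅θ 0 (π (g' (PresentedGroup.of (h, false)))), θ 0 (π (g' (PresentedGroup.of (h, true))))⁆, θ 0 (π (g' (PresentedGroup.of (h, false))))⁆ + (F'.symm (F (Pi.single ((0 : Fin 3), true) 1))) (h, true) • ⁅⁅θ 0 (π (g' (PresentedGroup.of (h, false)))), θ 0 (π (g' (PresentedGroup.of (h, true))))⁆, θ 0 (π (g' (PresentedGroup.of (h, true))))⁆)⁆ + ⁅((F'.symm (F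 (Pi.single ((0 : Fin 3), false) 1))) (h, false) • ⁅⁅θ 0 (π (g' (PresentedGroup.of (h, false)))), θ 0 (π (g' (PresentedGroup.of (h, true))))⁆, θ 0 (π (g' (PresentedGroup.of (h, false))))⁆ + (F'.symm (F (Pi.single ((0 : Fin 3), false) 1))) (h, true) • ⁅⁅θ 0 (π (g' (PresentedGroup.of (h, false)))), θ 0 (π (g' (PresentedGroup.of (h, true))))⁆, θ 0 (π (g' (PresentedGroup.of (h, true))))⁆), θ 0 (π (g (PresentedGroup.of ((0 : Fin 3), true))))⁆)) := by
  have hxIA : ∀ s, (g.symm.trans (β.trans g)) s * s⁻¹ ∈ (⊤ : Subgroup (SurfaceGroup 3)).lowerCentralSeries 1 := ia_conj hβIA g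
  have hU2 : ∀ s, (g'.symm.trans (T'.trans g')) s * s⁻¹ ∈ (⊤ : Subgroup (SurfaceGroup 3)).lowerCentralSeries 2 := fun s => by
    rw [conj_tau]; exact equiv_mem_lcs _ (hT2 _)
  obtain ⟨hV3, hd⟩ := datum_comm θ hadd hker hbr π hxIA hU2 X _ _ _ _ (conj_twist_class g' T' F' hg' h hT2 hTh hTne X)
    _ _ _ _ _ _ _ _ _ (bpconj_class β g F hβIA hβa0 hβb0 hβa1 hβb1 hβa2 hβb2 hg X)
  refine ⟨hV3, ?_⟩
  rw [hd, bpconj_datum θ hadd hker hbr π β g F hβIA hβa0 hβb0 hβa1 hβb1 hβa2 hβb2 hg (g' (PresentedGroup.of (h, false))),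
    bpconj_datum θ hadd hker hbr π β g F hβIA hβa0 hβb0 hβa1 hβb1 hβa2 hβb2 hg (g' (PresentedGroup.of (h, true))),
    datum_conj_twist' θ hadd hker hbr π g' T' F' hg' h hT2 hTh hTne (g (PresentedGroup.of ((0 : Fin 3), false))),
    datum_conj_twist' θ hadd hker hbr π g' T' F' hg' h hT2 hTh hTne (g (PresentedGroup.of ((0 : Fin 3), true))),
    datum_conj_twist' θ hadd hker hbr π g' T' F' hg' h hT2 hTh hTne (g (PresentedGroup.of ((1 : Fin 3), true)))⁻¹,
    map_inv π (g _), theta_inv θ hadd 0 (mem_top _)]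
  simp only [map_inv, toAdd_inv, hg, hg', SurfaceGroup.abelianize_of, toAdd_ofAdd]

include hadd hker hof hbr hπof in
/-- **The degree-three datum of `V = ⁅x₄, e₁₂ T₁ e₁₂⁻¹⁆`** given the class of `x₄(X)X⁻¹` modulo `γ₃` as
`⁅A,B⁆^{m₁}⁅A,B⁆^{m₂}⁅A,B⁆^{m₃}`: `datum_comm` with `conj_twist_class`, `datum_conj_twist'` and the degree-one data of
`x₄` (`x4_datum_P = 0`, `x4_datum_Q = ⁅-y₀, y₂⁆`) substituted. [folklore] -/
theorem datum_x4_type (x T' : SurfaceGroup 3 ≃* SurfaceGroup 3)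
    (hIA : ∀ s, x s * s⁻¹ ∈ (⊤ : Subgroup (SurfaceGroup 3)).lowerCentralSeries 1)
    (hx : ∀ l : surfaceGen 3, x (PresentedGroup.of l) = PresentedGroup.mk _ (z02.hom (w01.hom (z02.inv (w01.inv (FreeGroup.of l))))))
    (hT2 : ∀ s, T' s * s⁻¹ ∈ (⊤ : Subgroup (SurfaceGroup 3)).lowerCentralSeries 2)
    (hTh : ∀ c : Bool, T' (PresentedGroup.of ((1 : Fin 3), c)) * (PresentedGroup.of ((1 : Fin 3), c) : SurfaceGroup 3)⁻¹ =
      ⁅⁅(PresentedGroup.of ((1 : Fin 3), false) : SurfaceGroup 3), (PresentedGroup.of ((1 : Fin 3), true) : SurfaceGroup 3)⁆,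
        (PresentedGroup.of ((1 : Fin 3), c) : SurfaceGroup 3)⁆)
    (hTne : ∀ y : surfaceGen 3, y.1 ≠ (1 : Fin 3) → T' (PresentedGroup.of y) = PresentedGroup.of y)
    (X A B : SurfaceGroup 3) (m₁ m₂ m₃ : ℤ)
    (hxX : ((x X * X⁻¹ : SurfaceGroup 3) : SurfaceGroup 3 ⧸ (⊤ : Subgroup (SurfaceGroup 3)).lowerCentralSeries 2) =
      ((⁅A, B⁆ ^ m₁ * ⁅A, B⁆ ^ m₂ * ⁅A, B⁆ ^ m₃ : SurfaceGroup 3) : SurfaceGroup 3 ⧸ (⊤ : Subgroup (SurfaceGroup 3)).lowerCentralSeries 2)) :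
    (⁅(x : MulAut (SurfaceGroup 3)), (e12.toMulEquiv.symm.trans (T'.trans e12.toMulEquiv) : MulAut (SurfaceGroup 3))⁆ :
        MulAut (SurfaceGroup 3)) X * X⁻¹ ∈ (⊤ : Subgroup (SurfaceGroup 3)).lowerCentralSeries 3 ∧
    θ 3 (π ((⁅(x : MulAut (SurfaceGroup 3)), (e12.toMulEquiv.symm.trans (T'.trans e12.toMulEquiv) : MulAut (SurfaceGroup 3))⁆ :
        MulAut (SurfaceGroup 3)) X * X⁻¹)) =
      ((moveE 1).symm (toAdd (SurfaceGroup.abelianize 3 X))) ((1 : Fin 3), false) • (⁅⁅θ 0 (π (e12.toMulEquiv (PresentedGroup.of ((1 : Fin 3), false)))), θ 0 (π (e12.toMulEquiv (PresentedGroup.of ((1 : Fin 3), true))))⁆, (0 : FreeLieAlgebra ℤ (Fin 3))⁆ + ⁅⁅θ 0 (π (e12.toMulEquiv (PresentedGroup.of ((1 : Fin 3), false)))), ⁅-FreeLieAlgebra.of ℤ (0 : Fin 3), FreeLieAlgebra.of ℤ (2 : Fin 3)⁆⁆ + ⁅(0 : FreeLieAlgebra ℤ (Fin 3)), θ 0 (π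 (e12.toMulEquiv (PresentedGroup.of ((1 : Fin 3), true))))⁆, θ 0 (π (e12.toMulEquiv (PresentedGroup.of ((1 : Fin 3), false))))⁆) +
      ((moveE 1).symm (toAdd (SurfaceGroup.abelianize 3 X))) ((1 : Fin 3), true) • (⁅⁅θ 0 (π (e12.toMulEquiv (PresentedGroup.of ((1 : Fin 3), false)))), θ 0 (π (e12.toMulEquiv (PresentedGroup.of ((1 : Fin 3), true))))⁆, ⁅-FreeLieAlgebra.of ℤ (0 : Fin 3), FreeLieAlgebra.of ℤ (2 : Fin 3)⁆⁆ + ⁅⁅θ 0 (π (e12.toMulEquiv (PresentedGroup.of ((1 : Fin 3), false)))), ⁅-FreeLieAlgebra.of ℤ (0 : Fin 3), FreeLieAlgebra.of ℤ (2 : Fin 3)⁆⁆ + ⁅(0 : FreeLieAlgebra ℤ (Fin 3)), θ 0 (π (e12.toMulEquiv (PresentedGroup.of ((1 : Fin 3), true))))⁆, θ 0 (π (e12.toMulEquiv (PresentedGroup.of ((1 : Fin 3), true))))⁆) -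
      (m₁ • (⁅θ 0 (π A), (((moveE 1).symm (toAdd (SurfaceGroup.abelianize 3 B))) ((1 : Fin 3), false) • ⁅⁅θ 0 (π (e12.toMulEquiv (PresentedGroup.of ((1 : Fin 3), false)))), θ 0 (π (e12.toMulEquiv (PresentedGroup.of ((1 : Fin 3), true))))⁆, θ 0 (π (e12.toMulEquiv (PresentedGroup.of ((1 : Fin 3), false))))⁆ + ((moveE 1).symm (toAdd (SurfaceGroup.abelianize 3 B))) ((1 : Fin 3), true) • ⁅⁅θ 0 (π (e12.toMulEquiv (PresentedGroup.of ((1 : Fin 3), false)))), θ 0 (π (e12.toMulEquiv (PresentedGroup.of ((1 : Fin 3), true))))⁆, θ 0 (π (e12.toMulEquiv (PresentedGroup.of ((1 : Fin 3), true))))⁆)⁆ + ⁅(((moveE 1).symm (toAdd (SurfaceGroup.abelianize 3 A))) ((1 : Fin 3), false) • ⁅⁅θ 0 (π (e12.toMulEquiv (PresentedGroup.of ((1 : Fin 3), false)))), θ 0 (π (e12.toMulEquiv (PresentedGroup.of ((1 : Fin 3), true))))⁆, θ 0 (π (e12.toMulEquiv (PresentedGroup.of ((1 : Fin 3), false))))⁆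 + ((moveE 1).symm (toAdd (SurfaceGroup.abelianize 3 A))) ((1 : Fin 3), true) • ⁅⁅θ 0 (π (e12.toMulEquiv (PresentedGroup.of ((1 : Fin 3), false)))), θ 0 (π (e12.toMulEquiv (PresentedGroup.of ((1 : Fin 3), true))))⁆, θ 0 (π (e12.toMulEquiv (PresentedGroup.of ((1 : Fin 3), true))))⁆), θ 0 (π B)⁆) + m₂ • (⁅θ 0 (π A), (((moveE 1).symm (toAdd (SurfaceGroup.abelianize 3 B))) ((1 : Fin 3), false) • ⁅⁅θ 0 (π (e12.toMulEquiv (PresentedGroup.of ((1 : Fin 3), false)))), θ 0 (π (e12.toMulEquiv (PresentedGroup.of ((1 : Fin 3), true))))⁆, θ 0 (π (e12.toMulEquiv (PresentedGroup.of ((1 : Fin 3), false))))⁆ + ((moveE 1).symm (toAdd (SurfaceGroup.abelianize 3 B))) ((1 : Fin 3), true) • ⁅⁅θ 0 (π (e12.toMulEquiv (PresentedGroup.of ((1 : Fin 3), false)))), θ 0 (π (e12.toMulEquiv (PresentedGroup.of ((1 : Fin 3), true))))⁆, θ 0 (π (e12.toMulEquiv (PresentedGroup.of ((1 : Fin 3),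 true))))⁆)⁆ + ⁅(((moveE 1).symm (toAdd (SurfaceGroup.abelianize 3 A))) ((1 : Fin 3), false) • ⁅⁅θ 0 (π (e12.toMulEquiv (PresentedGroup.of ((1 : Fin 3), false)))), θ 0 (π (e12.toMulEquiv (PresentedGroup.of ((1 : Fin 3), true))))⁆, θ 0 (π (e12.toMulEquiv (PresentedGroup.of ((1 : Fin 3), false))))⁆ + ((moveE 1).symm (toAdd (SurfaceGroup.abelianize 3 A))) ((1 : Fin 3), true) • ⁅⁅θ 0 (π (e12.toMulEquiv (PresentedGroup.of ((1 : Fin 3), false)))), θ 0 (π (e12.toMulEquiv (PresentedGroup.of ((1 : Fin 3), true))))⁆, θ 0 (π (e12.toMulEquiv (PresentedGroup.of ((1 : Fin 3), true))))⁆), θ 0 (π B)⁆) + m₃ • (⁅θ 0 (π A), (((moveE 1).symm (toAdd (SurfaceGroup.abelianize 3 B))) ((1 : Fin 3), false) • ⁅⁅θ 0 (π (e12.toMulEquiv (PresentedGroup.of ((1 : Fin 3), false)))), θ 0 (π (e12.toMulEquiv (PresentedGroup.of ((1 : Fin 3), true))))⁆, θ 0 (π (e12.toMulEquiv (PresentedGroup.of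 ((1 : Fin 3), false))))⁆ + ((moveE 1).symm (toAdd (SurfaceGroup.abelianize 3 B))) ((1 : Fin 3), true) • ⁅⁅θ 0 (π (e12.toMulEquiv (PresentedGroup.of ((1 : Fin 3), false)))), θ 0 (π (e12.toMulEquiv (PresentedGroup.of ((1 : Fin 3), true))))⁆, θ 0 (π (e12.toMulEquiv (PresentedGroup.of ((1 : Fin 3), true))))⁆)⁆ + ⁅(((moveE 1).symm (toAdd (SurfaceGroup.abelianize 3 A))) ((1 : Fin 3), false) • ⁅⁅θ 0 (π (e12.toMulEquiv (PresentedGroup.of ((1 : Fin 3), false)))), θ 0 (π (e12.toMulEquiv (PresentedGroup.of ((1 : Fin 3), true))))⁆, θ 0 (π (e12.toMulEquiv (PresentedGroup.of ((1 : Fin 3), false))))⁆ + ((moveE 1).symm (toAdd (SurfaceGroup.abelianize 3 A))) ((1 : Fin 3), true) • ⁅⁅θ 0 (π (e12.toMulEquiv (PresentedGroup.of ((1 : Fin 3), false)))), θ 0 (π (e12.toMulEquiv (PresentedGroup.of ((1 : Fin 3), true))))⁆, θ 0 (π (e12.toMulEquiv (PresentedGroup.of ((1 : Fin 3), true))))⁆),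 θ 0 (π B)⁆)) := by
  obtain ⟨-, -, hc⟩ := e12_goeritz
  have hU2 : ∀ s, (e12.toMulEquiv.symm.trans (T'.trans e12.toMulEquiv)) s * s⁻¹ ∈ (⊤ : Subgroup (SurfaceGroup 3)).lowerCentralSeries 2 :=
    fun s => by rw [conj_tau]; exact equiv_mem_lcs _ (hT2 _)
  obtain ⟨hV3, hd⟩ := datum_comm θ hadd hker hbr π hIA hU2 X _ _ _ _ (conj_twist_class e12.toMulEquiv T' (moveE 1) hc 1 hT2 hTh hTne X)
    A B A B A B m₁ m₂ m₃ hxX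
  refine ⟨hV3, ?_⟩
  rw [hd, x4_datum_P θ hadd hker π hπof x hIA hx, x4_datum_Q θ hadd hker hof hbr π hπof x hIA hx,
    datum_conj_twist' θ hadd hker hbr π e12.toMulEquiv T' (moveE 1) hc 1 hT2 hTh hTne A,
    datum_conj_twist' θ hadd hker hbr π e12.toMulEquiv T' (moveE 1) hc 1 hT2 hTh hTne B]

end Symbols

end LayerZeroTwo

/-- **Registered helper `helper_layerZeroTwoCommAutGoeritz`** (sub-goal of stub `stub_layerStepZeroTwo`, item
stmt-SmoothPoincare4-14595): stabilisers are closed under the commutator `x U x⁻¹ U⁻¹` of `Aut S₃`, in closed form. [folklore] -/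
theorem helper_layerZeroTwoCommAutGoeritz : ∀ (P : Subgroup (Literature.Topology.FourManifolds.SurfaceGroup 3)) (x U : Literature.Topology.FourManifolds.SurfaceGroup 3 ≃* Literature.Topology.FourManifolds.SurfaceGroup 3), P.map x.toMonoidHom = P → P.map U.toMonoidHom = P → P.map (((U.symm.trans x.symm).trans U).trans x).toMonoidHom = P := by
  intro P x U hx hU
  rw [map_trans, map_trans, map_trans, map_symm_of_map _ hU, map_symm_of_map _ hx, hU, hx]

end Summit.SmoothPoincare4.SmoothPoincare4.Theorems.ShadowApproximation.NilpotentGenusClass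

end
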